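import Literature.AlgebraicGeometry.Frobenioids.Prop55Sub
import Literature.AlgebraicGeometry.Frobenioids.PerfectionStandardTypes
import Literature.AlgebraicGeometry.Frobenioids.PerfectionProofs
import Literature.AlgebraicGeometry.Frobenioids.PerfectionIsos
import Literature.AlgebraicGeometry.Frobenioids.PerfectionEndomorphisms
import Literature.AlgebraicGeometry.Frobenioids.PerfectionIsotropic
import Literature.AlgebraicGeometry.Frobenioids.CoAngular
import HarnessLib

/-!
# Frobenioids I, Prop. 5.5 (iii) / Def. 3.1 (i)(b) for THE perfection `C^pf`: descent of
# Frobenius-compactness from `A` to `(A, 1)` — the DESCENT LEMMA for GAP-LEDGER row G-w5d042-1 (P55-L06-b)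

Mochizuki, *The geometry of Frobenioids I: the general theory*, Kyushu J. Math. **62** (2008) 293–400,
Definition 1.2 (iv) "Frobenius-compact" p. 23, Definition 3.1 (i)(b) p. 56, Proposition 5.5 (i)/(iii)
p. 104 ll. 30–37, proof p. 105 ll. 17–18 ("by assertion (i) … `O^▷(−)` of the image of `A` in `(C^*)^pf` is
the perfection of `O^▷(A)`") [cite: MochizukiFrdI2008, Prop. 5.5 (iii) p.104].

PROOF-ONLY file (abc-iut cell, L1; sub-DAG row P55-L06 clause (b); GAP-LEDGER row G-w5d042-1; L1-lead
R95 (5); seat abc-iut-w5-d190).  `FrdI.Prop55Sub.prop55iii_pf_standard_of` (seat abc-iut-w5-d042) carries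
clause (b) of Def. 3.1 (i) for `C^pf` as the hypothesis `hb`.  Print's pointer, Prop. 5.5 (i)
(`O^▷((A,1)) = O^▷(A)^pf`), transports conditions (1) (commutativity of `O^×`) and (2) (a non-torsion unit)
of "Frobenius-compact" from `A` to `(A, 1)`, but is silent on condition (3), which quantifies over ALL
automorphisms `f = [θ]` of `(A, 1)`, `θ` an automorphism of a Frobenius POWER `A^{(c)}` (Prop. 3.2 (ii)).

SIBLING: `PerfectionFrobeniusCompact.lean` (abc-iut-w5-d042) proves conditions (1), (2) the same way and (3)
under the POWER-descent hypothesis `∀ f : Aut (A,1), ∃ M ≥ 1, f₀ : Aut A, f^M = toPf f₀`; the present file uses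
the weaker BASE-descent hypothesis (only `Base(f)` must descend) and DISCHARGES it for `Aut`-ample `A`.

WHAT IS PROVED HERE (kernel; no new definitions, nothing asserted beyond the theorems):
* `PreFrobenioidData.conj_mem_unitsSubgroup_of_mem`, `…mul_inv_mem_unitsSubgroup_of_base_eq`: over ANY
  pre-Frobenioid data, `O^×(A) ⊴ Aut(A)`, and two automorphisms with the same image in `Aut_D(A_D)` differ by a
  unit; hence (`…conj_eq_conj_of_base_eq`) when `O^×(A)` is commutative the conjugation action of `Aut(A)` on
  `O^×(A)` FACTORS THROUGH `Aut_D(A_D)` (the abstract form of [FrdII] Thm. 3.6 (iv), first sentence);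
* over THE perfection: an automorphism of `X = (A, n)` is the class of an ISOMORPHISM of some `A^{(c)}`
  (`exists_isIso_endClass_eq_descent`, the Prop. 3.2 (ii) representative), with
  `Base([θ]) = Base(frob_c) ≫ Base(θ) ≫ Base(frob_c)⁻¹`;
* `isFrobeniusCompact_toPf_of_baseDescent` — **the descent lemma**: for `A` Frobenius-compact in `C`, GIVEN
  Prop. 5.5 (i) at `A` BY NAME (`FrdI.Prop55Sub.Prop55i F hF A`, rows P55-L01/L02) and GIVEN that every base
  automorphism realised by an automorphism of a Frobenius power `A^{(c)}` is realised by an automorphism of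
  `A` (hypothesis `hdesc`), the object `(A, 1)` of `C^pf` is Frobenius-compact;
* `baseDescent_of_isAutAmple` — `hdesc` holds when `A` is `Aut`-ample ([FrdI] Def. 1.2 (iv)); so
  `hb_of_isAutAmple`: clause (b) for `C^pf` from clause (b) for `C` + Prop. 5.5 (i) + `Aut`-ampleness of the
  Frobenius-compact witness (e.g. model Frobenioids, [FrdI] Thm. 5.2).
Residual in general: `hdesc` at ONE Frobenius-compact isotropic `A`.  Nothing here bears on [IUTchIII] Cor. 3.12.
-/

namespace Literature.AlgebraicGeometry.Frobenioids

open CategoryTheory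

universe w v v' u u'

/-! ### `O^×(A)` is normal in `Aut(A)`; same base ⇒ differ by a unit (any pre-Frobenioid data) -/

namespace PreFrobenioidData

variable {C : Type u} [Category.{v} C] {D : Type u'} [Category.{v'} D] (S : PreFrobenioidData.{w} C D)

/-- The conjugate `f u f⁻¹` of a unit `u ∈ O^×(A)` by any automorphism `f` of `A` is again a unit
(`Base` is a functor, isomorphisms are linear). [cite: MochizukiFrdI2008, Def. 1.2 (ii) p.22] -/
theorem conj_mem_unitsSubgroup_of_mem {A : C} (f : Aut A) {u : Aut A} (hu : u ∈ S.unitsSubgroup A) :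
    f * u * f⁻¹ ∈ S.unitsSubgroup A := by
  refine ⟨?_, ?_⟩
  · change S.base.map (f.inv ≫ u.hom ≫ f.hom) = 𝟙 _
    rw [S.base.map_comp, S.base.map_comp, show S.base.map u.hom = 𝟙 _ from hu.1, Category.id_comp,
      ← S.base.map_comp, f.inv_hom_id, S.base.map_id]
  · change S.degFr (f.inv ≫ u.hom ≫ f.hom) = 1
    rw [S.degFr_comp, S.degFr_comp, show S.degFr u.hom = 1 from hu.2, one_mul]
    have h := S.degFr_comp f.inv f.hom
    rw [f.inv_hom_id, S.degFr_id] at h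
    exact h.symm

/-- Two automorphisms `f, f'` of `A` with the same image in `Aut_D(A_D)` differ by a unit:
`f * f'⁻¹ ∈ O^×(A)`. [cite: MochizukiFrdI2008, Def. 1.2 (ii) p.22] -/
theorem mul_inv_mem_unitsSubgroup_of_base_eq {A : C} (f f' : Aut A)
    (h : S.base.map f.hom = S.base.map f'.hom) : f * f'⁻¹ ∈ S.unitsSubgroup A := by
  refine ⟨?_, ?_⟩
  · change S.base.map (f'.inv ≫ f.hom) = 𝟙 _
    rw [S.base.map_comp, h, ← S.base.map_comp, f'.inv_hom_id, S.base.map_id]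
  · change S.degFr (f'.inv ≫ f.hom) = 1
    have h1 := S.degFr_comp f'.inv f'.hom
    rw [f'.inv_hom_id, S.degFr_id] at h1
    have h2 := S.degFr_comp f.inv f.hom
    rw [f.inv_hom_id, S.degFr_id] at h2
    have hf : S.degFr f.hom = 1 := (pnat_eq_one_of_mul_eq_one' h2.symm).2
    have hf' : S.degFr f'.inv = 1 := (pnat_eq_one_of_mul_eq_one' h1.symm).1
    rw [S.degFr_comp, hf, hf', mul_one]
  where
  /-- `a * b = 1` in `ℕ+` forces `a = b = 1`. -/
  pnat_eq_one_of_mul_eq_one' {a b : ℕ+} (h : a * b = 1) : a = 1 ∧ b = 1 := by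
    have h' : (a : ℕ) * (b : ℕ) = 1 := by rw [← PNat.mul_coe, h]; rfl
    exact ⟨PNat.coe_inj.mp (Nat.eq_one_of_mul_eq_one_right h'),
      PNat.coe_inj.mp (Nat.eq_one_of_mul_eq_one_left h')⟩

/-- **Conjugation factors through the base.** If `O^×(A)` is commutative, two automorphisms of `A` with
the same image in `Aut_D(A_D)` conjugate every unit of `A` identically (the abstract form of [FrdII]
Thm. 3.6 (iv), first sentence). [cite: MochizukiFrdI2008, Def. 1.2 (iv) p.23] -/
theorem conj_eq_conj_of_base_eq {A : C}
    (hcomm : ∀ u ∈ S.unitsSubgroup A, ∀ u' ∈ S.unitsSubgroup A, u * u' = u' * u) (f f' : Aut A)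
    (h : S.base.map f.hom = S.base.map f'.hom) {u : Aut A} (hu : u ∈ S.unitsSubgroup A) :
    f * u * f⁻¹ = f' * u * f'⁻¹ := by
  have hg := S.mul_inv_mem_unitsSubgroup_of_base_eq f f' h
  have hv := S.conj_mem_unitsSubgroup_of_mem f' hu
  have key := hcomm _ hg _ hv
  have hf : f = (f * f'⁻¹) * f' := by rw [mul_assoc, inv_mul_cancel, mul_one]
  -- `f = (f f'⁻¹) f'`, so `f u f⁻¹ = g (f' u f'⁻¹) g⁻¹ = f' u f'⁻¹`
  calc f * u * f⁻¹ = (f * f'⁻¹) * f' * u * ((f * f'⁻¹) * f')⁻¹ := by rw [← hf]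
    _ = (f * f'⁻¹) * (f' * u * f'⁻¹) * (f * f'⁻¹)⁻¹ := by simp only [mul_inv_rev, mul_assoc]
    _ = (f' * u * f'⁻¹) * (f * f'⁻¹) * (f * f'⁻¹)⁻¹ := by rw [key]
    _ = f' * u * f'⁻¹ := by rw [mul_inv_cancel_right]

end PreFrobenioidData

/-! ### Automorphisms of `(A, n)` in `C^pf` and their bases -/

namespace PreFrobenioid

namespace Perfection

variable {D : Type u} [Category.{v} D] {Φ : Dᵒᵖ ⥤ CommMonCat.{w}}
  {C : Type u'} [Category.{v'} C] {F : C ⥤ ElemFrobenioid Φ} {hF : IsFrobenioid F}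

/-- An automorphism of `X = (A, n)` in `C^pf` is the class of an ISOMORPHISM of some Frobenius power
`A^{(c)}` ([FrdI] Prop. 3.2 (ii): `Perfection.exists_isIso_lift_of_isIso`). (Same statement as
`exists_isIso_endClass_eq` of `Thm36SubAutActionQ.lean`; restated here to keep this file's imports to BUILT
modules.) [cite: MochizukiFrdI2008, Prop. 3.2 (ii) p.59] -/
theorem exists_isIso_endClass_eq_descent (X : Perfection hF) (f : X ⟶ X) [IsIso f] :
    ∃ (c : ℕ+) (θ : frobPow hF X.obj c ⟶ frobPow hF X.obj c), IsIso θ ∧ endClass X c θ = f := by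
  obtain ⟨c₀, θ₀, e₀⟩ := exists_endClass_eq X f
  have hiso : IsIso (X := X) (Y := X) (Hom.mk ⟨Level.diag X c₀, θ₀⟩) := by
    rw [← endClass_def, e₀]; infer_instance
  obtain ⟨⟨a, b, hab⟩, hN, hI⟩ := exists_isIso_lift_of_isIso ⟨Level.diag X c₀, θ₀⟩ hiso
  obtain rfl : a = b := mul_left_cancel hab
  refine ⟨a, Level.lift (Level.diag X c₀) ⟨a, a, hab⟩ hN θ₀, hI, ?_⟩
  rw [← e₀]
  exact Hom.mk_lift ⟨Level.diag X c₀, θ₀⟩ ⟨a, a, hab⟩ hN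

/-- `Base([θ]) = Base(frob_c) ≫ Base(θ) ≫ Base(frob_c)⁻¹` in `D`. [cite: MochizukiFrdI2008, Prop. 3.2 (i) p.58] -/
theorem baseMap_endClass (X : Perfection hF) (c : ℕ+) (θ : frobPow hF X.obj c ⟶ frobPow hF X.obj c) :
    Hom.baseMap (endClass X c θ) = Base F (frob hF X.obj c) ≫ Base F θ ≫ baseInvFrob hF X.obj c := rfl

/-! ### The units of `(A, 1)` against the units of `A` (Prop. 5.5 (i)) -/

section Units

variable (A : C)

/-- The functor `C → C^pf` carries units of `A` to units of `(A, 1)` (it lies over `D` on the nose: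
`baseMap_toPf`; isomorphisms are linear). [cite: MochizukiFrdI2008, Prop. 5.5 (i) p.104] -/
theorem mapAut_toPf_mem_unitsSubgroup {u : Aut A} (hu : u ∈ unitsSubgroup F A) :
    (toPf hF).mapAut A u ∈ (ops hF).unitsSubgroup ((toPf hF).obj A) := by
  refine ⟨?_, ?_⟩
  · change Hom.baseMap ((toPf hF).map u.hom) = 𝟙 _
    rw [baseMap_toPf]
    exact hu.1
  · exact isLinear_of_isIso (ops hF).toFunctor ((toPf hF).mapIso u).hom

variable {A}

/-- An element of the commutative monoid `O^▷(A)` that becomes a unit in the perfection `O^▷(A)^pf` is a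
unit of `O^▷(A)` (FrdI §0: `(a,1)·(b,m) = 1` unwinds to `(a^m b)^N = 1`).
[cite: MochizukiFrdI2008, §0 p.11] -/
theorem isUnit_of_isUnit_of {M : Type*} [CommMonoid M] {a : M}
    (h : IsUnit (Frobenioids.Perfection.of M a)) : IsUnit a := by
  obtain ⟨y, hy⟩ := h.exists_right_inv
  obtain ⟨⟨b, m⟩, rfl⟩ := Frobenioids.Perfection.mk_surjective y
  change Frobenioids.Perfection.of M a * Frobenioids.Perfection.mk b m = 1 at hy
  rw [Frobenioids.Perfection.of_apply, Frobenioids.Perfection.mk_mul_mk,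
    Frobenioids.Perfection.mk_eq_one_iff] at hy
  obtain ⟨N, hN⟩ := hy
  rw [PNat.one_coe, pow_one, mul_pow, ← pow_mul] at hN
  have hpos : 0 < (m : ℕ) * (N : ℕ) := Nat.mul_pos m.pos N.pos
  obtain ⟨k, hk⟩ : ∃ k, (m : ℕ) * (N : ℕ) = k + 1 := ⟨_, (Nat.succ_pred_eq_of_pos hpos).symm⟩
  rw [hk, pow_succ] at hN
  exact isUnit_iff_exists_inv.mpr ⟨a ^ k * b ^ (N : ℕ), by
    calc a * (a ^ k * b ^ (N : ℕ)) = a ^ k * a * b ^ (N : ℕ) := by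
          rw [← mul_assoc, mul_comm a (a ^ k)]
      _ = 1 := hN⟩

end Units

/-! ### Powers in `Aut` versus powers in `End` -/

/-- `(u ^ N).hom` is the `N`-th power of `u.hom` in `End` (`f * g = g ≫ f` in `End`, `x * y = y ≪≫ x` in `Aut`).
[folklore] -/
private theorem hom_pow_eq {𝒞 : Type*} [Category 𝒞] {Y : 𝒞} (u : Aut Y) (N : ℕ) :
    (u ^ N).hom = (show End Y from u.hom) ^ N := by
  induction N with
  | zero => rfl
  | succ n ih =>
    rw [pow_succ, pow_succ, Aut.Aut_mul_def, Iso.trans_hom, ih]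
    rfl

/-! ### The descent lemma -/

section Descent

variable (hF) (A : C)

/-- **Prop. 5.5 (i) consequence: `C → C^pf` is injective modulo torsion on `O^▷(A)`.** If two elements of
`O^▷(A)` have the same image in `End_{C^pf}((A,1))`, some positive powers of them coincide
(`O^▷((A,1)) = O^▷(A)^pf`, FrdI §0: `of a = of b ⟺ ∃ N, a^N = b^N`).
[cite: MochizukiFrdI2008, Prop. 5.5 (i) p.104] -/
theorem exists_pow_eq_of_toPf_map_eq
    (e : @Frobenioids.Perfection (endSubmonoid F A) (endCommMonoid F hF A) ≃*
        (ops hF).endSubmonoid ((toPf hF).obj A))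
    (he : ∀ α : endSubmonoid F A,
      (e (@Frobenioids.Perfection.of (endSubmonoid F A) (endCommMonoid F hF A) α)).1 =
        (toPf hF).map (show A ⟶ A from α.1))
    (a b : endSubmonoid F A) (h : (toPf hF).map (show A ⟶ A from a.1) = (toPf hF).map (show A ⟶ A from b.1)) :
    ∃ N : ℕ+, a ^ (N : ℕ) = b ^ (N : ℕ) := by
  have h1 : e (@Frobenioids.Perfection.of _ (endCommMonoid F hF A) a) =
      e (@Frobenioids.Perfection.of _ (endCommMonoid F hF A) b) :=
    Subtype.ext ((he a).trans (h.trans (he b).symm))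
  exact (@Frobenioids.Perfection.of_eq_of_iff _ (endCommMonoid F hF A) a b).mp (e.injective h1)

/-- The same for units, in `Aut A`: if two units of `A` have the same image under
`Aut A → Aut (A,1)`, some positive powers of them coincide. [cite: MochizukiFrdI2008, Prop. 5.5 (i) p.104] -/
theorem exists_pow_eq_of_mapAut_eq
    (e : @Frobenioids.Perfection (endSubmonoid F A) (endCommMonoid F hF A) ≃*
        (ops hF).endSubmonoid ((toPf hF).obj A))
    (he : ∀ α : endSubmonoid F A,
      (e (@Frobenioids.Perfection.of (endSubmonoid F A) (endCommMonoid F hF A) α)).1 =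
        (toPf hF).map (show A ⟶ A from α.1))
    {x y : Aut A} (hx : x ∈ unitsSubgroup F A) (hy : y ∈ unitsSubgroup F A)
    (h : (toPf hF).mapAut A x = (toPf hF).mapAut A y) :
    ∃ N : ℕ+, x ^ (N : ℕ) = y ^ (N : ℕ) := by
  have h' : (toPf hF).map x.hom = (toPf hF).map y.hom := congrArg Iso.hom h
  obtain ⟨N, hN⟩ := exists_pow_eq_of_toPf_map_eq hF A e he ⟨x.hom, hx⟩ ⟨y.hom, hy⟩ h'
  refine ⟨N, Aut.ext ?_⟩
  rw [hom_pow_eq, hom_pow_eq]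
  exact congrArg Subtype.val hN

/-- **Prop. 5.5 (i) consequence: `C → C^pf` is surjective modulo torsion on units.** Every unit `u` of
`(A, 1)` in `C^pf` has a positive power that is the image of a unit of `A` (every element of `O^▷(A)^pf` has
a power in `O^▷(A)`; an element of `O^▷(A)` invertible in the perfection is invertible).
[cite: MochizukiFrdI2008, Prop. 5.5 (i) p.104] -/
theorem exists_pow_eq_mapAut
    (e : @Frobenioids.Perfection (endSubmonoid F A) (endCommMonoid F hF A) ≃*
        (ops hF).endSubmonoid ((toPf hF).obj A))
    (he : ∀ α : endSubmonoid F A,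
      (e (@Frobenioids.Perfection.of (endSubmonoid F A) (endCommMonoid F hF A) α)).1 =
        (toPf hF).map (show A ⟶ A from α.1))
    {u : Aut ((toPf hF).obj A)} (hu : u ∈ (ops hF).unitsSubgroup ((toPf hF).obj A)) :
    ∃ (M : ℕ+) (x : Aut A), x ∈ unitsSubgroup F A ∧ (toPf hF).mapAut A x = u ^ (M : ℕ) := by
  -- `u.hom` as a UNIT of the monoid `O^▷((A,1))`
  let U : (ops hF).endSubmonoid ((toPf hF).obj A) := ⟨u.hom, hu.1, hu.2⟩
  have hu' : u⁻¹ ∈ (ops hF).unitsSubgroup ((toPf hF).obj A) := Subgroup.inv_mem _ hu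
  let U' : (ops hF).endSubmonoid ((toPf hF).obj A) := ⟨u.inv, hu'.1, hu'.2⟩
  have hUU' : U * U' = 1 := Subtype.ext u.inv_hom_id
  have hU'U : U' * U = 1 := Subtype.ext u.hom_inv_id
  have hU : IsUnit U := ⟨⟨U, U', hUU', hU'U⟩, rfl⟩
  -- write `e.symm U = (a, m)`; then `U^m = e (of a)` and `a` is a unit of `O^▷(A)`
  obtain ⟨⟨a, m⟩, ham⟩ := @Frobenioids.Perfection.mk_surjective _ (endCommMonoid F hF A) (e.symm U)
  dsimp only at ham
  have hUm : U ^ (m : ℕ) = e (@Frobenioids.Perfection.of _ (endCommMonoid F hF A) a) := by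
    have h1 : e (@Frobenioids.Perfection.mk _ (endCommMonoid F hF A) a m) = U := by
      rw [ham, MulEquiv.apply_symm_apply]
    have h1' : e.toMonoidHom (@Frobenioids.Perfection.mk _ (endCommMonoid F hF A) a m) = U := h1
    rw [← @Frobenioids.Perfection.mk_pow_self _ (endCommMonoid F hF A) a m]
    change U ^ (m : ℕ) = e.toMonoidHom (@Frobenioids.Perfection.mk _ (endCommMonoid F hF A) a m ^ (m : ℕ))
    rw [map_pow, h1']
  have hz : IsUnit (e (@Frobenioids.Perfection.of _ (endCommMonoid F hF A) a)) := hUm ▸ hU.pow _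
  have ha : @IsUnit _ (endCommMonoid F hF A).toMonoid a := by
    refine @isUnit_of_isUnit_of _ (endCommMonoid F hF A) a ?_
    obtain ⟨W, hW⟩ := hz.exists_right_inv
    refine isUnit_iff_exists_inv.mpr ⟨e.symm W, e.injective ?_⟩
    rw [MulEquiv.map_mul, MulEquiv.apply_symm_apply, hW]
    exact (MulEquiv.map_one e).symm
  obtain ⟨a', ha1⟩ := ha.exists_left_inv
  have ha1' : a' * a = 1 := ha1
  have ha2' : a * a' = 1 := by rw [endSubmonoid_comm F hF a a']; exact ha1'
  -- the unit of `A`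
  let x : Aut A := ⟨a.1, a'.1, congrArg Subtype.val ha1', congrArg Subtype.val ha2'⟩
  refine ⟨m, x, ⟨a.2.1, a.2.2⟩, Aut.ext ?_⟩
  change (toPf hF).map (show A ⟶ A from a.1) = (u ^ (m : ℕ)).hom
  rw [← he a, ← hUm, hom_pow_eq]
  rfl

/-- **Units of `(A, 1)` commute** (`O^▷((A,1)) ≅ O^▷(A)^pf` is commutative).
[cite: MochizukiFrdI2008, Prop. 5.5 (i) p.104] -/
theorem units_comm_of_prop55i
    (e : @Frobenioids.Perfection (endSubmonoid F A) (endCommMonoid F hF A) ≃*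
        (ops hF).endSubmonoid ((toPf hF).obj A)) :
    ∀ u ∈ (ops hF).unitsSubgroup ((toPf hF).obj A), ∀ u' ∈ (ops hF).unitsSubgroup ((toPf hF).obj A),
      u * u' = u' * u := by
  intro u hu u' hu'
  let U : (ops hF).endSubmonoid ((toPf hF).obj A) := ⟨u.hom, hu.1, hu.2⟩
  let U' : (ops hF).endSubmonoid ((toPf hF).obj A) := ⟨u'.hom, hu'.1, hu'.2⟩
  have hc : U * U' = U' * U := by
    apply e.symm.injective
    rw [MulEquiv.map_mul, MulEquiv.map_mul, mul_comm]
  apply Aut.ext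
  exact congrArg Subtype.val hc

/-- **THE DESCENT LEMMA** ([FrdI] Def. 3.1 (i)(b) / Prop. 5.5 (iii) for `C^pf`, the missing input of
GAP-LEDGER row G-w5d042-1): let `A` be an isotropic object of the Frobenioid `C` (of Frobenius-isotropic
and Frobenius-normalized type) that is FROBENIUS-COMPACT; assume Prop. 5.5 (i) at `A`
(`O^▷(A)^pf ⥲ O^▷((A,1))`, row P55-L01/L02, BY NAME) and the BASE-DESCENT hypothesis `hdesc`: every base
automorphism of `Base(A^{(c)}) ≅ Base(A)` realised by an automorphism of a Frobenius power `A^{(c)}` is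
realised by an automorphism of `A`.  Then the object `(A, 1)` of `C^pf` is Frobenius-compact.  Mechanism:
an automorphism `f = [θ]` of `(A,1)` (`θ ∈ Aut_C(A^{(c)})`, Prop. 3.2 (ii)) and the image `f'` of the descended
`θ₀ ∈ Aut_C(A)` have the same base, so — `O^×((A,1))` being commutative — they conjugate `O^×((A,1))`
identically; the `p/q`-hypothesis for `f` descends to `θ₀` modulo torsion and the conclusion for `θ₀`
ascends modulo torsion, through Prop. 5.5 (i). [cite: MochizukiFrdI2008, Prop. 5.5 (iii) p.104] -/
theorem isFrobeniusCompact_toPf_of_baseDescent (hiso : IsOfType (IsFrobeniusIsotropic F))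
    (hnorm : IsOfType (IsFrobeniusNormalized F)) (hA : IsIsotropic F A)
    (h55 : FrdI.Prop55Sub.Prop55i F hF A)
    (hcpt : (PreFrobenioidData.ofFunctor Φ F).IsFrobeniusCompact A)
    (hdesc : ∀ (c : ℕ+) (θ : Aut (frobPow hF A c)), ∃ θ₀ : Aut A,
      Base F θ₀.hom = Base F (frob hF A c) ≫ Base F θ.hom ≫ baseInvFrob hF A c) :
    (ops hF).IsFrobeniusCompact ((toPf hF).obj A) := by
  obtain ⟨e, he⟩ := h55 hiso hnorm hA
  obtain ⟨hcommA, ⟨υ₀, hυ₀, hυ₀tors⟩, h3⟩ := hcpt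
  have hcommX := units_comm_of_prop55i hF A e
  refine ⟨hcommX, ?_, ?_⟩
  · -- (2) a non-torsion unit: the image of `υ₀`
    refine ⟨(toPf hF).mapAut A υ₀, mapAut_toPf_mem_unitsSubgroup A hυ₀, fun N hN hN1 => ?_⟩
    rw [← map_pow, ← map_one ((toPf hF).mapAut A)] at hN1
    obtain ⟨N', hN'⟩ := exists_pow_eq_of_mapAut_eq hF A e he (Subgroup.pow_mem _ hυ₀ N)
      (Subgroup.one_mem _) hN1
    rw [one_pow, ← pow_mul] at hN'
    exact hυ₀tors (N * N') (Nat.mul_pos hN N'.pos) hN'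
  · -- (3) automorphisms acting by `p/q` act trivially
    intro f p q hpq u hu
    obtain ⟨c, θ, hθ, hfθ⟩ := exists_isIso_endClass_eq_descent ((toPf hF).obj A) f.hom
    haveI := hθ
    obtain ⟨θ₀, hθ₀⟩ := hdesc c (asIso θ)
    -- `f` and the image `f'` of `θ₀` have the same base, hence conjugate units identically
    have hbase : (ops hF).base.map f.hom = (ops hF).base.map ((toPf hF).mapAut A θ₀).hom := by
      change Hom.baseMap f.hom = Hom.baseMap ((toPf hF).map θ₀.hom)
      rw [baseMap_toPf, hθ₀, ← hfθ]
      rfl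
    have hconj : ∀ w ∈ (ops hF).unitsSubgroup ((toPf hF).obj A),
        f * w * f⁻¹ = (toPf hF).mapAut A θ₀ * w * ((toPf hF).mapAut A θ₀)⁻¹ :=
      fun w hw => (ops hF).conj_eq_conj_of_base_eq hcommX f _ hbase hw
    -- the `p/q`-hypothesis descends to `θ₀`
    have hypA : ∀ x ∈ (PreFrobenioidData.ofFunctor Φ F).unitsSubgroup A,
        ∃ N : ℕ, 0 < N ∧ ((θ₀ * x * θ₀⁻¹) ^ (q : ℕ)) ^ N = (x ^ (p : ℕ)) ^ N := by
      intro x hx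
      obtain ⟨N, hN, hEq⟩ := hpq _ (mapAut_toPf_mem_unitsSubgroup A hx)
      rw [hconj _ (mapAut_toPf_mem_unitsSubgroup A hx), ← map_inv, ← map_mul, ← map_mul, ← map_pow,
        ← map_pow, ← map_pow, ← map_pow] at hEq
      have hmem₁ : ((θ₀ * x * θ₀⁻¹) ^ (q : ℕ)) ^ N ∈ unitsSubgroup F A :=
        Subgroup.pow_mem _ (Subgroup.pow_mem _
          ((PreFrobenioidData.ofFunctor Φ F).conj_mem_unitsSubgroup_of_mem θ₀ hx) _) _
      have hmem₂ : (x ^ (p : ℕ)) ^ N ∈ unitsSubgroup F A :=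
        Subgroup.pow_mem _ (Subgroup.pow_mem _ hx _) _
      obtain ⟨N', hN'⟩ := exists_pow_eq_of_mapAut_eq hF A e he hmem₁ hmem₂ hEq
      refine ⟨N * N', Nat.mul_pos hN N'.pos, ?_⟩
      rw [pow_mul, pow_mul, hN']
    have h3A := h3 θ₀ p q hypA
    -- ascend: `u^M = ι x`, and the conclusion for `x` gives the conclusion for `u`
    obtain ⟨M, x, hx, hxu⟩ := exists_pow_eq_mapAut hF A e he hu
    obtain ⟨N, hN, hNx⟩ := h3A x hx
    refine ⟨M * N, Nat.mul_pos M.pos hN, ?_⟩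
    rw [pow_mul, pow_mul, conj_pow, ← hxu, hconj _ (mapAut_toPf_mem_unitsSubgroup A hx), ← map_inv,
      ← map_mul, ← map_mul, ← map_pow, hNx, map_pow]

/-- **The base-descent hypothesis holds for `Aut`-ample `A`** ([FrdI] Def. 1.2 (iv): `Aut_C(A) → Aut_D(A_D)`
surjective): the transported base automorphism `Base(frob_c) ≫ Base(θ) ≫ Base(frob_c)⁻¹` of `A_D` lifts
to `A`. [cite: MochizukiFrdI2008, Def. 1.2 (iv) p.23] -/
theorem baseDescent_of_isAutAmple (hamp : IsAutAmple F A) (c : ℕ+) (θ : Aut (frobPow hF A c)) :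
    ∃ θ₀ : Aut A, Base F θ₀.hom = Base F (frob hF A c) ≫ Base F θ.hom ≫ baseInvFrob hF A c := by
  haveI := isIso_base_frob hF A c
  haveI : IsIso (baseInvFrob hF A c) :=
    ⟨⟨Base F (frob hF A c), baseInvFrob_base_frob hF A c, base_frob_baseInvFrob hF A c⟩⟩
  -- the transported base automorphism, as an automorphism of `(baseFunctor F).obj A`
  let g₁ : baseObj F A ≅ baseObj F (frobPow hF A c) := asIso (Base F (frob hF A c))
  let g₃ : baseObj F (frobPow hF A c) ≅ baseObj F A := asIso (baseInvFrob hF A c)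
  let g : (PreFrobenioid.baseFunctor F).obj A ≅ (PreFrobenioid.baseFunctor F).obj A :=
    g₁ ≪≫ (PreFrobenioid.baseFunctor F).mapIso θ ≪≫ g₃
  obtain ⟨θ₀, hθ₀⟩ := hamp g
  exact ⟨θ₀, congrArg Iso.hom hθ₀⟩

/-- **Def. 3.1 (i)(b) for `C^pf` from `C`, for an `Aut`-ample witness** — the hypothesis `hb` of
`FrdI.Prop55Sub.prop55iii_pf_standard_of` DISCHARGED whenever the Frobenius-compact isotropic object of `C`
provided by clause (b) for `C` can be chosen `Aut`-ample, GIVEN Prop. 5.5 (i) at that object: "if `C^pf` is of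
group-like type [iff `C` is], then `(C^pf)^istr` [= `C^pf`] has a Frobenius-compact object", namely `(A,1)`.
[cite: MochizukiFrdI2008, Prop. 5.5 (iii) p.104] -/
theorem hb_of_isAutAmple (hiso : IsOfType (IsFrobeniusIsotropic F)) (hnorm : IsOfType (IsFrobeniusNormalized F))
    (hbC : (PreFrobenioidData.ofFunctor Φ F).IsOfGroupLikeType → ∃ A : C,
      (PreFrobenioidData.ofFunctor Φ F).IsIsotropic A ∧ (PreFrobenioidData.ofFunctor Φ F).IsFrobeniusCompact A ∧
        IsAutAmple F A ∧ FrdI.Prop55Sub.Prop55i F hF A) :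
    (ops hF).IsOfGroupLikeType →
      ∃ X : Perfection hF, (ops hF).IsIsotropic X ∧ (ops hF).IsFrobeniusCompact X := by
  intro hGL
  obtain ⟨A, hA, hcpt, hamp, h55⟩ := hbC ((isOfGroupLikeType_ops_iff hF).mp hGL)
  exact ⟨(toPf hF).obj A, (isOfIsotropicType_perfection hF hiso).obj _,
    isFrobeniusCompact_toPf_of_baseDescent hF A hiso hnorm ((PreFrobenioidData.ofFunctor_isIsotropic F A).mp hA)
      h55 hcpt (baseDescent_of_isAutAmple hF A hamp)⟩

end Descent

end Perfection

end PreFrobenioid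

end Literature.AlgebraicGeometry.Frobenioids
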